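import Literature.AlgebraicGeometry.Resolution.PrincipalRidgeHassePPow
import Literature.AlgebraicGeometry.Resolution.AdditiveFormsStructure
import Literature.AlgebraicGeometry.Resolution.DerivativeIdeals
import Mathlib.RingTheory.MvPolynomial.Ideal
import Mathlib.Algebra.CharP.Lemmas
import HarnessLib

/-!
# The cone-level criterion for maximal contact: a form of degree `m` prime to `p` has a non-zero LINEAR Hasse–Schmidt derivative; wild forms; sharpness of the derivation-based maximal contact ideal at `m ≥ p`

Topic: `Literature/AlgebraicGeometry/Resolution`. Kollár, *Lectures on Resolution of
Singularities* (2007), Def. 3.79 ("the maximal contact ideal of `I` is `MC(I) := D^{m-1}(I)`") and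
Lemma 3.74 (3) — flagged "(char. 0 only!)" — / Thm. 3.80: at a point where `ord I = m`, `MC(I)` has
order `1`, because a degree-`m` form over a field of characteristic zero has a non-zero partial
derivative of degree `m − 1` (Euler). Hauser, *The Hironaka theorem on resolution of
singularities*, Bull. AMS 40 (2003), §4 problem (9): hypersurfaces of maximal contact "only work in
characteristic zero (or a characteristic prime to the order of the ideal considered)". This file
proves the TANGENT-CONE statements behind these sentences, in every characteristic, with the
Hasse–Schmidt derivatives `D^{(B)}` of the tree (`hasseDeriv`, `HasseSchmidtDerivatives.lean`; EGA
IV₄ 16.11) in place of iterated first-order derivations: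

* `exists_hasseDeriv_ne_zero_of_natCast_mul_ne_zero` — **Euler**: a form `ψ` of degree `m` with
  `m · ψ ≠ 0` has a NON-ZERO Hasse–Schmidt derivative `D^{(B)} ψ` with `|B| + 1 = m`, which is a
  linear form (the Euler identity `Σ_{|B| = m−1} x^B D^{(B)} ψ = m ψ` of `PrincipalRidgeHassePPow.lean`);
  `…_of_natCast_ne_zero` (domains, `(m : R) ≠ 0`), **`…_of_not_dvd`** (characteristic `p ∤ m`):
  Hauser's "characteristic prime to the order";
* `coeff_single_hasseDeriv_sub_single` — `coeff_{e_i}(D^{(A − e_i)} ψ) = A_i · coeff_A ψ`;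
  **`dvd_of_forall_hasseDeriv_eq_zero`** — if ALL `D^{(B)} ψ`, `|B| + 1 = m`, vanish (a WILD form),
  then every exponent of every monomial of `ψ` is divisible by `p` (`ψ ∈ R[x_1^p, …, x_n^p]`), so
  `p ∣ m` (`char_dvd_of_forall_hasseDeriv_eq_zero`); the pure power `x_i^m` is wild iff `p ∣ m`
  (`hasseDeriv_X_pow_degree_pred`, `forall_hasseDeriv_X_pow_eq_zero_iff`);
* `hasseDeriv_mem_diffIdeal_span_singleton`, **`exists_linear_mem_diffIdeal_of_not_dvd`** — hence
  for `p ∤ m` Grothendieck's `Diff^{≤ m−1}((ψ))` (`diffIdeal`, all characteristics) contains a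
  non-zero LINEAR form, and so does Giraud's ridge ideal `𝔉((ψ))`
  (`exists_linear_mem_ridgeIdeal_of_not_dvd`, through BHM Lemma 3.6
  `ridgeIdeal_span_singleton_eq_span_hasseCoefficientsPPow`): at a point of order `m` prime to `p`
  the tangent cone of a hypersurface has a maximal-contact hyperplane;
* **the derivation-based ideal is blind from `m = p` on**: for `m ≥ p` (characteristic `p > 0`)
  the BGMW/Kollár iterated-derivation ideals `𝒟^j((x_i^m))` (`derivIdealIter`,
  `DerivativeIdeals.lean`) all lie in `(x_i^{p·⌊m/p⌋}) ⊆ 𝔪^p ⊆ 𝔪²`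
  (`derivIdealIter_span_X_pow_le`, `derivIdealIter_span_X_pow_le_idealOfVars_sq`): Kollár's
  `MC((x_i^m)) = 𝒟^{m-1}((x_i^m))` contains NO element of order `≤ 1` at the origin although, for
  `p ∤ m`, `Diff^{≤ m−1}((x_i^m)) ∋ m·x_i` does (`X_mem_diffIdeal_span_X_pow`,
  `diffIdeal_span_X_pow_not_le_idealOfVars_sq`). So the honest range
  of the derivation-based maximal contact theorem (`KollarMaximalContactTame.lean`: `m < p`) is
  sharp for the machinery at every `m ≥ p`, while the geometric obstruction (Narasimhan, Kollár
  Aside 3.57; `Literature.Barriers.ResolutionOfSingularities.NarasimhanMaximalContact`) needs a wild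
  tangent form.

* (v2) `hasseDeriv_eq_zero_of_forall_dvd`, **`forall_hasseDeriv_eq_zero_iff_forall_dvd`** — the converse
  (Kummer/Lucas): forms supported on `R[x_1^p, …, x_n^p]` are wild, so over a domain of prime
  characteristic `p` a form is wild iff all its exponents are divisible by `p`.

## Sources

* J. Kollár, *Lectures on Resolution of Singularities* (2007): Lemma 3.74 (3), Def. 3.79,
  Thm. 3.80, Aside 3.57. [Kollar2007]
* H. Hauser, Bull. AMS 40 (2003), §4 problem (9), §14 Example 1. [Hauser2003]
* A. Grothendieck, ÉGA IV₄, Thm. 16.11.2 (`D_p(z^q) = binom(q,p) z^{q−p}`). [EGAIV4]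
* J. Berthomieu, P. Hivert, H. Mourtada, *Computing Hironaka's invariants: ridge and directrix*
  (2010), Lemma 3.6. [BerthomieuHivertMourtada2010]
-/

noncomputable section

open MvPolynomial
open scoped BigOperators

namespace Literature.AlgebraicGeometry.Resolution

/-! ## 1. Euler: forms of degree prime to the characteristic have a non-zero linear Hasse–Schmidt derivative -/

section Euler

variable {σ : Type*} {R : Type*} [CommRing R]

/-- **Euler's lemma for Hasse–Schmidt derivatives**: if `ψ` is a form of degree `m` and `m · ψ ≠ 0`,
then some Hasse–Schmidt derivative `D^{(B)} ψ` with `|B| + 1 = m` is non-zero (from the Euler identity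
`Σ_{|B| = m−1} x^B · D^{(B)} ψ = binom(m, m−1) ψ = m ψ`, EGA IV₄ 16.11.2 /
`sum_monomial_mul_hasseDeriv_eq_choose_mul`). This is the computation behind Kollár's Lemma 3.74 (3)
("char. 0 only!": there `m ≠ 0` always). [cite: Kollar2007, Lemma 3.74 (3)] [cite: EGAIV4, Thm. 16.11.2] -/
theorem exists_hasseDeriv_ne_zero_of_natCast_mul_ne_zero {ψ : MvPolynomial σ R} {m : ℕ}
    (hψ : ψ.IsHomogeneous m) (h : (m : MvPolynomial σ R) * ψ ≠ 0) :
    ∃ B : σ →₀ ℕ, B.degree + 1 = m ∧ hasseDeriv R B ψ ≠ 0 := by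
  classical
  have hm : 1 ≤ m := by
    rcases Nat.eq_zero_or_pos m with rfl | hm
    · exact absurd (by rw [Nat.cast_zero, zero_mul]) h
    · exact hm
  by_contra hne
  push Not at hne
  apply h
  have hchoose : m.choose (m - 1) = m := by
    rw [← Nat.choose_symm (Nat.sub_le m 1), show m - (m - 1) = 1 by omega, Nat.choose_one_right]
  have hsum := sum_monomial_mul_hasseDeriv_eq_choose_mul hψ (m - 1)
  rw [hchoose] at hsum
  rw [← hsum]
  refine Finset.sum_eq_zero fun B hB => ?_
  rw [hne B (by have := (Finset.mem_filter.mp hB).2; omega), mul_zero]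

/-- The non-zero derivative of `exists_hasseDeriv_ne_zero_of_natCast_mul_ne_zero` is a LINEAR form
(`D^{(B)}` lowers the degree of a form by `|B|`). [cite: EGAIV4, Thm. 16.11.2] -/
theorem isHomogeneous_one_hasseDeriv [DecidableEq σ] {ψ : MvPolynomial σ R} {m : ℕ}
    (hψ : ψ.IsHomogeneous m) {B : σ →₀ ℕ} (hB : B.degree + 1 = m) :
    (hasseDeriv R B ψ).IsHomogeneous 1 := by
  have h := isHomogeneous_hasseDeriv_of_isHomogeneous hψ B
  rwa [show m - B.degree = 1 by omega] at h

/-- **Over a domain**: a non-zero form `ψ` of degree `m` with `m ≠ 0` in `R` has a non-zero linear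
Hasse–Schmidt derivative `D^{(B)} ψ`, `|B| + 1 = m`. [cite: Kollar2007, Lemma 3.74 (3)] -/
theorem exists_hasseDeriv_ne_zero_of_natCast_ne_zero [IsDomain R] {ψ : MvPolynomial σ R} {m : ℕ}
    (hψ : ψ.IsHomogeneous m) (hψ0 : ψ ≠ 0) (hm : (m : R) ≠ 0) :
    ∃ B : σ →₀ ℕ, B.degree + 1 = m ∧ hasseDeriv R B ψ ≠ 0 := by
  refine exists_hasseDeriv_ne_zero_of_natCast_mul_ne_zero hψ ?_
  rw [← map_natCast (C : R →+* MvPolynomial σ R) m]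
  exact mul_ne_zero (by rwa [Ne, C_eq_zero]) hψ0

/-- **"A characteristic prime to the order"** (Hauser 2003, §4 (9)): over a domain of characteristic
`p` with `p ∤ m`, every non-zero form of degree `m` has a non-zero linear Hasse–Schmidt derivative
`D^{(B)} ψ`, `|B| + 1 = m` — the tangent cone admits a maximal-contact hyperplane `D^{(B)} ψ = 0`.
(`p = 0` allowed: then `p ∤ m` says `m ≠ 0`.) [cite: Hauser2003, §4 problem (9)] [cite: Kollar2007, Aside 3.57] -/
theorem exists_hasseDeriv_ne_zero_of_not_dvd (p : ℕ) [CharP R p] [IsDomain R]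
    {ψ : MvPolynomial σ R} {m : ℕ} (hψ : ψ.IsHomogeneous m) (hψ0 : ψ ≠ 0) (hpm : ¬ p ∣ m) :
    ∃ B : σ →₀ ℕ, B.degree + 1 = m ∧ hasseDeriv R B ψ ≠ 0 :=
  exists_hasseDeriv_ne_zero_of_natCast_ne_zero hψ hψ0 (by rwa [Ne, CharP.cast_eq_zero_iff R p])

end Euler

/-! ## 2. Wild forms: all linear Hasse–Schmidt derivatives vanish only on `R[x_1^p, …, x_n^p]` -/

section Wild

variable {σ : Type*} [DecidableEq σ] {R : Type*} [CommRing R]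

/-- **`coeff_{e_i}(D^{(A − e_i)} ψ) = A_i · coeff_A(ψ)`** for `A_i ≠ 0` (the multi-binomial
`∏_j binom(A_j, (A − e_i)_j) = binom(A_i, A_i − 1) = A_i`). [cite: EGAIV4, Thm. 16.11.2 (16.11.2.1)] -/
theorem coeff_single_hasseDeriv_sub_single (ψ : MvPolynomial σ R) {A : σ →₀ ℕ} {i : σ}
    (hi : A i ≠ 0) :
    coeff (Finsupp.single i 1) (hasseDeriv R (A - Finsupp.single i 1) ψ) = (A i : R) * coeff A ψ := by
  have hle : Finsupp.single i 1 ≤ A := Finsupp.single_le_iff.mpr (Nat.one_le_iff_ne_zero.mpr hi)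
  have h := coeff_sub_hasseDeriv (R := R) (tsub_le_self : A - Finsupp.single i 1 ≤ A) ψ
  rw [tsub_tsub_cancel_of_le hle] at h
  rw [h]
  congr 1
  rw [Finset.prod_eq_single i]
  · obtain ⟨n, hn⟩ := Nat.exists_eq_succ_of_ne_zero hi
    rw [Finsupp.tsub_apply, Finsupp.single_eq_same, hn, Nat.succ_sub_one, Nat.choose_succ_self_right]
  · intro j _ hji
    rw [Finsupp.tsub_apply, Finsupp.single_eq_of_ne hji, Nat.sub_zero, Nat.choose_self]
  · intro hi'
    rw [Finsupp.notMem_support_iff.mp hi', Nat.choose_zero_right]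

/-- **Wild forms lie in `R[x_1^p, …, x_n^p]`**: over a domain of characteristic `p` (`p = 0` allowed),
if ALL Hasse–Schmidt derivatives `D^{(B)} ψ` with `|B| + 1 = m` of a form `ψ` of degree `m` vanish,
then every exponent of every monomial of `ψ` is divisible by `p` (read `coeff_{e_i}` of
`D^{(A − e_i)} ψ = 0`: `A_i · coeff_A ψ = 0`). This is the "wild point" of the transfer problem: no
linear Hasse coefficient, no cone-level maximal contact coordinate.
[cite: Kollar2007, Aside 3.57] [cite: EGAIV4, Thm. 16.11.2 (16.11.2.1)] -/
theorem dvd_of_forall_hasseDeriv_eq_zero (p : ℕ) [CharP R p] [IsDomain R] {ψ : MvPolynomial σ R}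
    {m : ℕ} (hψ : ψ.IsHomogeneous m)
    (hD : ∀ B : σ →₀ ℕ, B.degree + 1 = m → hasseDeriv R B ψ = 0) {A : σ →₀ ℕ}
    (hA : A ∈ ψ.support) (i : σ) : p ∣ A i := by
  by_cases hi : A i = 0
  · rw [hi]; exact dvd_zero p
  have hle : Finsupp.single i 1 ≤ A := Finsupp.single_le_iff.mpr (Nat.one_le_iff_ne_zero.mpr hi)
  have hAd : A.degree = m := by
    have := hψ (mem_support_iff.mp hA)
    rwa [Finsupp.degree_eq_weight_one]
  have hBd : (A - Finsupp.single i 1).degree + 1 = m := by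
    have h1 : (A - Finsupp.single i 1).degree + (Finsupp.single i 1).degree = A.degree := by
      rw [← map_add, tsub_add_cancel_of_le hle]
    rw [Finsupp.degree_single] at h1
    omega
  have h := coeff_single_hasseDeriv_sub_single (R := R) ψ hi
  rw [hD _ hBd, coeff_zero] at h
  have h0 : (A i : R) = 0 :=
    (mul_eq_zero.mp h.symm).resolve_right (mem_support_iff.mp hA)
  exact (CharP.cast_eq_zero_iff R p (A i)).mp h0

omit [DecidableEq σ] in
/-- Hence **a non-zero wild form has degree divisible by `p`** (`m = Σ_i A_i` for any monomial
`x^A` of `ψ`); contrapositive of `exists_hasseDeriv_ne_zero_of_not_dvd`. [cite: Kollar2007, Aside 3.57] -/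
theorem char_dvd_of_forall_hasseDeriv_eq_zero (p : ℕ) [CharP R p] [IsDomain R]
    {ψ : MvPolynomial σ R} {m : ℕ} (hψ : ψ.IsHomogeneous m) (hψ0 : ψ ≠ 0)
    (hD : ∀ B : σ →₀ ℕ, B.degree + 1 = m → hasseDeriv R B ψ = 0) : p ∣ m := by
  by_contra hpm
  obtain ⟨B, hB, hne⟩ := exists_hasseDeriv_ne_zero_of_not_dvd p hψ hψ0 hpm
  exact hne (hD B hB)

/-- **The pure power**: `D^{((m−1) e_i)}(x_i^m) = m · x_i` (EGA IV₄ (16.11.2.1) with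
`binom(m, m−1) = m`), for `m ≥ 1`. [cite: EGAIV4, Thm. 16.11.2 (16.11.2.1)] -/
theorem hasseDeriv_X_pow_degree_pred (i : σ) {m : ℕ} (hm : 1 ≤ m) :
    hasseDeriv R (Finsupp.single i (m - 1)) (X i ^ m : MvPolynomial σ R) =
      (m : MvPolynomial σ R) * X i := by
  rw [hasseDeriv_X_pow, ← Nat.choose_symm (Nat.sub_le m 1), show m - (m - 1) = 1 by omega,
    Nat.choose_one_right, pow_one]

/-- **`x_i^m` is wild iff `p ∣ m`**: over a domain of characteristic `p`, all Hasse–Schmidt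
derivatives `D^{(B)}(x_i^m)` with `|B| + 1 = m` vanish iff `p ∣ m` (for `m ≥ 1`; the only candidate
is `B = (m−1) e_i`, with value `m · x_i`). The case `m = p`: Kollár's Aside 3.57 / Narasimhan.
[cite: Kollar2007, Aside 3.57] [cite: EGAIV4, Thm. 16.11.2 (16.11.2.1)] -/
theorem forall_hasseDeriv_X_pow_eq_zero_iff (p : ℕ) [CharP R p] [IsDomain R] (i : σ) {m : ℕ}
    (hm : 1 ≤ m) :
    (∀ B : σ →₀ ℕ, B.degree + 1 = m → hasseDeriv R B (X i ^ m : MvPolynomial σ R) = 0) ↔ p ∣ m := by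
  constructor
  · intro hD
    exact char_dvd_of_forall_hasseDeriv_eq_zero p (isHomogeneous_X_pow i m)
      (pow_ne_zero m (X_ne_zero i)) hD
  · intro hpm B hB
    -- `D^{(B)}(x_i^m) ≠ 0` forces `B ≤ m e_i`, i.e. `B = (m-1) e_i`, whose value is `m x_i = 0`
    by_cases hBle : B ≤ Finsupp.single i m
    · have hBi : B = Finsupp.single i (B i) := by
        ext j
        by_cases hji : j = i
        · subst hji; rw [Finsupp.single_eq_same]
        · rw [Finsupp.single_eq_of_ne hji]
          have := hBle j
          rwa [Finsupp.single_eq_of_ne hji, Nat.le_zero] at this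
      have hBdeg : B.degree = B i := by
        conv_lhs => rw [hBi]
        exact Finsupp.degree_single _ _
      rw [hBi, ← hBdeg, show B.degree = m - 1 by omega, hasseDeriv_X_pow_degree_pred i hm,
        (CharP.cast_eq_zero_iff (MvPolynomial σ R) p m).mpr hpm, zero_mul]
    · rw [X_pow_eq_monomial, hasseDeriv_monomial_eq_zero_of_not_le R hBle]

end Wild

/-! ## 3. Consequences: `Diff^{≤ m−1}((ψ))` and the ridge ideal contain a non-zero linear form when `p ∤ m` -/

section DiffIdeal

variable {σ : Type*} [DecidableEq σ] {R : Type*} [CommRing R]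

/-- The Hasse–Schmidt derivatives `D^{(B)} ψ`, `|B| + 1 = m`, lie in Grothendieck's
`Diff^{≤ m−1}((ψ))` (`diffIdeal`, every characteristic). [cite: EGAIV4, Thm. 16.11.2] -/
theorem hasseDeriv_mem_diffIdeal_span_singleton (ψ : MvPolynomial σ R) {m : ℕ} {B : σ →₀ ℕ}
    (hB : B.degree + 1 = m) : hasseDeriv R B ψ ∈ diffIdeal R (m - 1) (Ideal.span {ψ}) :=
  hasseDeriv_apply_mem_diffIdeal R (by omega) (Ideal.subset_span (Set.mem_singleton ψ))

/-- **Cone-level maximal contact for `p ∤ m`, differential-operator form**: over a domain of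
characteristic `p` with `p ∤ m`, for every non-zero form `ψ` of degree `m` the ideal
`Diff^{≤ m−1}((ψ))` contains a NON-ZERO LINEAR FORM (Kollár's Lemma 3.74 (3) "`MC(I)` has order `1`",
with Hasse–Schmidt operators; Hauser's "characteristic prime to the order").
[cite: Kollar2007, Lemma 3.74 (3), Def. 3.79] [cite: Hauser2003, §4 problem (9)] -/
theorem exists_linear_mem_diffIdeal_of_not_dvd (p : ℕ) [CharP R p] [IsDomain R]
    {ψ : MvPolynomial σ R} {m : ℕ} (hψ : ψ.IsHomogeneous m) (hψ0 : ψ ≠ 0) (hpm : ¬ p ∣ m) :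
    ∃ ℓ ∈ diffIdeal R (m - 1) (Ideal.span {ψ}), ℓ.IsHomogeneous 1 ∧ ℓ ≠ 0 := by
  obtain ⟨B, hB, hne⟩ := exists_hasseDeriv_ne_zero_of_not_dvd p hψ hψ0 hpm
  exact ⟨hasseDeriv R B ψ, hasseDeriv_mem_diffIdeal_span_singleton ψ hB,
    isHomogeneous_one_hasseDeriv hψ hB, hne⟩

end DiffIdeal

section Ridge

universe u

variable {K : Type u} [Field K] {n : ℕ}

/-- The Hasse–Schmidt derivatives `D^{(B)} h`, `|B| + 1 = d`, of a form `h` of degree `d` lie in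
Giraud's ridge ideal `𝔉((h))` (BHM Cor. 2.3: `𝔉((h)) = ⟨D_A h : |A| < d⟩`,
`ridgeIdeal_span_singleton_eq_span_hasseCoefficients`; every characteristic).
[cite: BerthomieuHivertMourtada2010, Cor. 2.3, Lemma 3.6] -/
theorem hasseDeriv_mem_ridgeIdeal_span_singleton {h : MvPolynomial (Fin n) K} {d : ℕ}
    (hh : h.IsHomogeneous d) {B : Fin n →₀ ℕ} (hB : B.degree + 1 = d) :
    hasseDeriv K B h ∈ ridgeIdeal (Ideal.span {h}) := by
  rw [ridgeIdeal_span_singleton_eq_span_hasseCoefficients hh]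
  exact Ideal.subset_span ⟨B, by omega, rfl⟩

/-- **Cone-level maximal contact for `p ∤ d`, ridge form**: over a field of characteristic `p`
with `p ∤ d`, the ridge ideal `𝔉((h))` of every non-zero form `h` of degree `d` contains a NON-ZERO
LINEAR FORM `ℓ` — the ridge (and the directrix) of the cone `h = 0` lies in the hyperplane
`ℓ = 0`, a maximal-contact coordinate at the tangent-cone level. For `d < p` ALL generators of
`𝔉((h))` are linear (`PrincipalRidgeLinearTame.lean`); at `d = p`, `h = x_0^p` has none.
[cite: Kollar2007, Aside 3.57] [cite: BerthomieuHivertMourtada2010, Lemma 3.6] -/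
theorem exists_linear_mem_ridgeIdeal_of_not_dvd (p : ℕ) [CharP K p] {h : MvPolynomial (Fin n) K}
    {d : ℕ} (hh : h.IsHomogeneous d) (h0 : h ≠ 0) (hpd : ¬ p ∣ d) :
    ∃ ℓ ∈ ridgeIdeal (Ideal.span {h}), ℓ.IsHomogeneous 1 ∧ ℓ ≠ 0 := by
  obtain ⟨B, hB, hne⟩ := exists_hasseDeriv_ne_zero_of_not_dvd p hh h0 hpd
  exact ⟨hasseDeriv K B h, hasseDeriv_mem_ridgeIdeal_span_singleton hh hB,
    isHomogeneous_one_hasseDeriv hh hB, hne⟩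

end Ridge

/-! ## 4. The derivation-based maximal contact ideal is blind from `m = p` on -/

section DerivationBlind

variable {σ : Type*} (K : Type*) [CommRing K] (p : ℕ) [CharP K p]

/-- In characteristic `p`, the principal ideal `(x_i^{p q})` is stable under EVERY `K`-derivation
(`δ(x_i^{pq} g) = pq·x_i^{pq−1} δ(x_i) g + x_i^{pq} δ g`), so BGMW's `𝒟((x_i^{pq})) = (x_i^{pq})`.
[cite: BierstoneGrigorievMilmanWlodarczyk2011, Def. 3.5.1] -/
theorem derivIdeal_span_X_pow_char_mul (i : σ) (q : ℕ) :
    derivIdeal K (Ideal.span {(X i ^ (p * q) : MvPolynomial σ K)}) = Ideal.span {X i ^ (p * q)} := by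
  refine le_antisymm ((derivIdeal_le_iff K).mpr ⟨le_rfl, fun δ f hf => ?_⟩) (le_derivIdeal K _)
  obtain ⟨g, rfl⟩ := Ideal.mem_span_singleton'.mp hf
  have hpq : ((p * q : ℕ) : MvPolynomial σ K) = 0 := by
    rw [Nat.cast_mul, CharP.cast_eq_zero, zero_mul]
  rw [Derivation.leibniz, Derivation.leibniz_pow, nsmul_eq_mul, hpq, zero_mul, smul_zero, zero_add,
    smul_eq_mul]
  exact Ideal.mul_mem_right _ _ (Ideal.subset_span (Set.mem_singleton _))

/-- Hence all iterated derivative ideals `𝒟^j((x_i^{pq}))` equal `(x_i^{pq})`.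
[cite: BierstoneGrigorievMilmanWlodarczyk2011, Def. 3.5.1] -/
theorem derivIdealIter_span_X_pow_char_mul (i : σ) (q j : ℕ) :
    derivIdealIter K j (Ideal.span {(X i ^ (p * q) : MvPolynomial σ K)}) = Ideal.span {X i ^ (p * q)} := by
  induction j with
  | zero => rfl
  | succ j ih => rw [derivIdealIter_succ, ih, derivIdeal_span_X_pow_char_mul]

/-- **`𝒟^j((x_i^m)) ⊆ (x_i^{p·⌊m/p⌋})` for every `j`** (characteristic `p`): the iterated first-order
derivatives of `x_i^m` never get past the largest `p`-th-power-multiple exponent below `m`.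
[cite: BierstoneGrigorievMilmanWlodarczyk2011, Def. 3.5.1] -/
theorem derivIdealIter_span_X_pow_le (i : σ) (m j : ℕ) :
    derivIdealIter K j (Ideal.span {(X i ^ m : MvPolynomial σ K)}) ≤
      Ideal.span {X i ^ (p * (m / p))} := by
  have hle : Ideal.span {(X i ^ m : MvPolynomial σ K)} ≤ Ideal.span {X i ^ (p * (m / p))} :=
    Ideal.span_singleton_le_span_singleton.mpr (pow_dvd_pow _ (Nat.mul_div_le m p))
  exact (derivIdealIter_mono K j hle).trans (derivIdealIter_span_X_pow_char_mul K p i (m / p) j).le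

/-- **Kollár's derivation-based `MC((x_i^m)) = 𝒟^{m−1}((x_i^m))` has order `≥ 2` at the origin for
every `m ≥ p`** (characteristic `p` prime): all `𝒟^j((x_i^m))` lie in `(x_i^{p⌊m/p⌋}) ⊆ 𝔪^p ⊆ 𝔪²`,
`𝔪 = (x_1, …, x_n)` — no section of order `1`, no hypersurface of maximal contact in the sense of
Kollár's Thm. 3.80 through the origin, although for `p ∤ m` the hyperplane `x_i = 0` is one
geometrically (`X_mem_diffIdeal_span_X_pow`). This is the sharpness, for the derivation-based
machinery, of the tame range `m < p` of `KollarMaximalContactTame.lean`.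
[cite: Kollar2007, Def. 3.79, Aside 3.57] [cite: BierstoneGrigorievMilmanWlodarczyk2011, Def. 3.5.1, Thm. 8.0.4] -/
theorem derivIdealIter_span_X_pow_le_idealOfVars_sq [Fact p.Prime] (i : σ) {m : ℕ} (hm : p ≤ m)
    (j : ℕ) : derivIdealIter K j (Ideal.span {(X i ^ m : MvPolynomial σ K)}) ≤ idealOfVars σ K ^ 2 := by
  refine (derivIdealIter_span_X_pow_le K p i m j).trans ?_
  rw [Ideal.span_singleton_le_iff_mem]
  have hp : p.Prime := Fact.out
  have h2 : 2 ≤ p * (m / p) :=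
    hp.two_le.trans (Nat.le_mul_of_pos_right p (Nat.div_pos hm hp.pos))
  have hX : (X i : MvPolynomial σ K) ∈ idealOfVars σ K := Ideal.subset_span (Set.mem_range_self i)
  exact Ideal.pow_le_pow_right h2 (Ideal.pow_mem_pow hX _)

variable {K p} in
/-- … whereas **`Diff^{≤ m−1}((x_i^m)) ∋ x_i` as soon as `m` is a unit** (e.g. `K` a field with
`p ∤ m`): `D^{((m−1)e_i)}(x_i^m) = m·x_i` (`hasseDeriv_X_pow_degree_pred`). [cite: EGAIV4, Thm. 16.11.2 (16.11.2.1)]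
[cite: VillamayorU2008ReesDiff, §4.1] -/
theorem X_mem_diffIdeal_span_X_pow [DecidableEq σ] (i : σ) {m : ℕ} (hm : 1 ≤ m)
    (hunit : IsUnit (m : K)) :
    (X i : MvPolynomial σ K) ∈ diffIdeal K (m - 1) (Ideal.span {(X i ^ m : MvPolynomial σ K)}) := by
  have h := hasseDeriv_mem_diffIdeal_span_singleton (R := K) (X i ^ m : MvPolynomial σ K)
    (B := Finsupp.single i (m - 1)) (m := m) (by rw [Finsupp.degree_single]; omega)
  rw [hasseDeriv_X_pow_degree_pred i hm] at h
  obtain ⟨u, hu⟩ := hunit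
  have e : (X i : MvPolynomial σ K) = C (↑u⁻¹ : K) * ((m : MvPolynomial σ K) * X i) := by
    rw [← mul_assoc, ← map_natCast C m, ← map_mul, ← hu, Units.inv_mul, C_1, one_mul]
  have h' := Ideal.mul_mem_left _ (C (↑u⁻¹ : K)) h
  rwa [← e] at h'

/-- `x_i ∉ 𝔪²`. [folklore] -/
private theorem X_notMem_idealOfVars_sq [Nontrivial K] (i : σ) :
    (X i : MvPolynomial σ K) ∉ idealOfVars σ K ^ 2 := by
  rw [X, monomial_mem_pow_idealOfVars_iff 2 _ one_ne_zero, Finsupp.degree_single]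
  omega

variable {K p} in
/-- **The contrast at the origin**: for `m` a unit in `K` (`K` non-trivial), Grothendieck's
`Diff^{≤ m−1}((x_i^m))` is NOT contained in `𝔪²` — it contains the order-one element `x_i`
(Villamayor's order criterion via `Diff^{b−1}`: `ord_0 (x_i^m) = m`, not more) — while for `m ≥ p`
the derivation-based `𝒟^{m−1}((x_i^m))` is (`derivIdealIter_span_X_pow_le_idealOfVars_sq`).
[cite: VillamayorU2008ReesDiff, §4.1] [cite: EGAIV4, Thm. 16.11.2 (16.11.2.1)] -/
theorem diffIdeal_span_X_pow_not_le_idealOfVars_sq [DecidableEq σ] [Nontrivial K] (i : σ) {m : ℕ}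
    (hm : 1 ≤ m) (hunit : IsUnit (m : K)) :
    ¬ diffIdeal K (m - 1) (Ideal.span {(X i ^ m : MvPolynomial σ K)}) ≤ idealOfVars σ K ^ 2 :=
  fun h => X_notMem_idealOfVars_sq K i (h (X_mem_diffIdeal_span_X_pow i hm hunit))

end DerivationBlind

/-! ## 5. The converse: forms supported on `R[x_1^p, …, x_n^p]` are wild (appended, v2) -/

section WildConverse

variable {σ : Type*} [DecidableEq σ] {R : Type*} [CommRing R]

/-- **Kummer/Lucas**: for a prime `p`, if `p ∣ n` and `p ∤ k` then `p ∣ binom(n, k)` (Lucas: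
`binom(n, k) ≡ binom(n mod p, k mod p) · binom(n/p, k/p) (mod p)` and `binom(0, k mod p) = 0`). [folklore] -/
private theorem dvd_choose_of_dvd_of_not_dvd (p : ℕ) [hp : Fact p.Prime] {n k : ℕ} (hn : p ∣ n)
    (hk : ¬ p ∣ k) : p ∣ n.choose k := by
  have h := Choose.choose_modEq_choose_mod_mul_choose_div_nat (n := n) (k := k) (p := p)
  have hn0 : n % p = 0 := Nat.mod_eq_zero_of_dvd hn
  have hk0 : k % p ≠ 0 := fun h0 => hk (Nat.dvd_of_mod_eq_zero h0)
  rw [hn0, Nat.choose_eq_zero_of_lt (Nat.pos_of_ne_zero hk0), zero_mul] at h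
  exact (Nat.modEq_zero_iff_dvd.mp h)

/-- **Forms supported on monomials with all exponents divisible by `p` are wild in every direction
`B` with some `p ∤ B_i`**: in characteristic `p` (prime), if every monomial `x^A` of `ψ` has `p ∣ A_i`
for all `i`, then `D^{(B)} ψ = 0` whenever some `B_i` is prime to `p` (each multi-binomial
`∏_j binom(A_j, B_j)` has the factor `binom(A_i, B_i) ≡ 0`, Kummer/Lucas).
[cite: EGAIV4, Thm. 16.11.2 (16.11.2.1)] [cite: Kollar2007, Aside 3.57] -/
theorem hasseDeriv_eq_zero_of_forall_dvd (p : ℕ) [hp : Fact p.Prime] [CharP R p]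
    {ψ : MvPolynomial σ R} (hψ : ∀ A ∈ ψ.support, ∀ i, p ∣ A i) {B : σ →₀ ℕ} {i : σ}
    (hi : ¬ p ∣ B i) : hasseDeriv R B ψ = 0 := by
  conv_lhs => rw [ψ.as_sum, map_sum]
  refine Finset.sum_eq_zero fun A hA => ?_
  rw [hasseDeriv_monomial]
  have hiB : i ∈ B.support := Finsupp.mem_support_iff.mpr fun h => hi (h ▸ dvd_zero p)
  have hdvd : p ∣ ∏ j ∈ B.support, (A j).choose (B j) :=
    (dvd_choose_of_dvd_of_not_dvd p (hψ A hA i) hi).trans (Finset.dvd_prod_of_mem _ hiB)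
  rw [(CharP.cast_eq_zero_iff (MvPolynomial σ R) p _).mpr hdvd, zero_mul]

/-- **Wild forms: the criterion in both directions.** Over a domain of prime characteristic `p`, for
a form `ψ` of degree `m`: ALL Hasse–Schmidt derivatives `D^{(B)} ψ`, `|B| + 1 = m`, vanish iff every
monomial of `ψ` has all its exponents divisible by `p` (`ψ ∈ R[x_1^p, …, x_n^p]`). (`⇒`:
`dvd_of_forall_hasseDeriv_eq_zero`; `⇐`: then `p ∣ m`, so `|B| ≡ −1 (mod p)` and some `B_i` is prime
to `p`.) [cite: Kollar2007, Aside 3.57] [cite: EGAIV4, Thm. 16.11.2 (16.11.2.1)] -/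
theorem forall_hasseDeriv_eq_zero_iff_forall_dvd (p : ℕ) [hp : Fact p.Prime] [CharP R p] [IsDomain R]
    {ψ : MvPolynomial σ R} {m : ℕ} (hψ : ψ.IsHomogeneous m) :
    (∀ B : σ →₀ ℕ, B.degree + 1 = m → hasseDeriv R B ψ = 0) ↔
      ∀ A ∈ ψ.support, ∀ i, p ∣ A i := by
  refine ⟨fun hD A hA i => dvd_of_forall_hasseDeriv_eq_zero p hψ hD hA i, fun h B hB => ?_⟩
  by_cases hψ0 : ψ = 0
  · rw [hψ0, map_zero]
  -- some `B_i` is prime to `p`: otherwise `p ∣ |B|` and `p ∣ m = |B| + 1`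
  obtain ⟨A, hA⟩ := MvPolynomial.support_nonempty.mpr hψ0
  have hAd : A.degree = m := by
    have := hψ (mem_support_iff.mp hA)
    rwa [Finsupp.degree_eq_weight_one]
  have hpm : p ∣ m := by
    rw [← hAd, Finsupp.degree_apply]
    exact Finset.dvd_sum fun i _ => h A hA i
  have hex : ∃ i, ¬ p ∣ B i := by
    by_contra hall
    push Not at hall
    have hB' : p ∣ B.degree := by
      rw [Finsupp.degree_apply]
      exact Finset.dvd_sum fun i _ => hall i
    have h1 : p ∣ 1 := by
      have := (Nat.dvd_add_right hB').mp (hB ▸ hpm : p ∣ B.degree + 1)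
      exact this
    exact hp.out.one_lt.ne' (Nat.dvd_one.mp h1)
  obtain ⟨i, hi⟩ := hex
  exact hasseDeriv_eq_zero_of_forall_dvd p h hi

end WildConverse

end Literature.AlgebraicGeometry.Resolution

end
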